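import Summits.Ventures.Crystal3D.Theorems.StickyWulffConstantNoReconstructionGainSlabForm
import Summits.Ventures.Crystal3D.Theorems.StickyWulffConstantNoReconstructionGainRegistry
import HarnessLib

/-!
# 30°-caps about the twelve bond directions: local geometry and the bond star

HONEST FRAMING. Part of the venture `Summits/Ventures/Crystal3D` (cell `crystal3d-full`), helper
`--supports` the crux `NoReconstructionGain` (stmt-Ventures-19144, route
`route-Ventures-StickyWulffConstant`), line `adhesion`; infrastructure for the every-normal GAIN
IDENTITY of `…NoReconstructionGainInterstitialGain` (wulff-p1 g10).

A contact `x ∼ q` (distance exactly `1`) is REGISTERED to the bond direction `d` (a unit vector of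
the substrate lattice `Λ₀ = fccStacking 1 √(2/3)`) when `⟪x − q, d⟫ > √3/2`, i.e. `x − q` lies in
the open cap of angular radius `30°` about `d`; it is INTERSTITIAL when it is registered to no bond
direction.  The two facts that drive the chain/flow argument:

* `real_inner_gt_half_of_caps`, `dist_lt_one_of_caps` — two unit vectors in the same open `30°`-cap
  are at inner product `> 1/2`, so two contacts of one ball in one cap would be `< 1` apart: in a
  unit packing EVERY CAP HOLDS AT MOST ONE CONTACT (`capPartner_unique`);
* `real_inner_le_half_of_fcc_unit`, `capDir_unique` — distinct unit vectors of `Λ₀` have inner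
  product `≤ 1/2` (they are `≥ 1` apart), so a contact is registered to AT MOST ONE direction.

Also: `norm_sub_lt_one_of_cap` (the empty lattice slot behind a registered contact is blocked),
the explicit BOND STAR `±u, ±v, ±(u−v), ±t, ±(u−t), ±(v−t)` as a `Finset` with its three
properties (`fccBondStar_mem`, `fccBondStar_neg_mem`, `fccBondStar_card`: unit lattice vectors,
closed under negation, twelve of them), and the abstract double count `card_filter_exists_comm`.

WHAT THIS IS NOT: no statement about films; rung F-C1 not moved.
-/

noncomputable section

namespace Summit.Ventures.Crystal3D.Theorems

open Summit.Ventures.Crystal3D Finset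
open Literature.MathematicalPhysics.StatisticalMechanics (barlowPos barlowStacking fccStacking constHagg
  barlowPos_mem isHaggSeq_const le_dist_of_mem_barlowStacking_ideal mem_barlowStacking_iff)
open scoped InnerProductSpace

/-! ### Caps of angular radius `30°` -/

/-- `√3/2 < 1` and `0 < √3/2`. -/
theorem sqrt_three_div_two_bounds : 0 < Real.sqrt 3 / 2 ∧ Real.sqrt 3 / 2 < 1 ∧ 1 < Real.sqrt 3 := by
  have h3 : Real.sqrt 3 ^ 2 = 3 := Real.sq_sqrt (by norm_num)
  have h0 : 0 ≤ Real.sqrt 3 := Real.sqrt_nonneg 3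
  refine ⟨by positivity, by nlinarith, by nlinarith⟩

/-- **Two unit vectors in one open `30°`-cap make an angle `< 60°`.**  If `‖u‖ = ‖v‖ = ‖w‖ = 1`
and `⟪u, w⟫, ⟪v, w⟫ > √3/2` then `⟪u, v⟫ > 1/2`. -/
theorem real_inner_gt_half_of_caps {u v w : EuclideanSpace ℝ (Fin 3)} (hu : ‖u‖ = 1) (hv : ‖v‖ = 1)
    (hw : ‖w‖ = 1) (huw : Real.sqrt 3 / 2 < ⟪u, w⟫_ℝ) (hvw : Real.sqrt 3 / 2 < ⟪v, w⟫_ℝ) :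
    1 / 2 < ⟪u, v⟫_ℝ := by
  obtain ⟨hc0, hc1, -⟩ := sqrt_three_div_two_bounds
  have hcc : (Real.sqrt 3 / 2) ^ 2 = 3 / 4 := by rw [div_pow, Real.sq_sqrt (by norm_num)]; norm_num
  set a := ⟪u, w⟫_ℝ with ha
  set b := ⟪v, w⟫_ℝ with hb
  have ha1 : a ≤ 1 := by
    have := abs_real_inner_le_norm u w; rw [hu, hw] at this; exact (abs_le.1 (by linarith)).2
  have hb1 : b ≤ 1 := by
    have := abs_real_inner_le_norm v w; rw [hv, hw] at this; exact (abs_le.1 (by linarith)).2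
  set x := u - a • w with hx
  set y := v - b • w with hy
  have hww : ⟪w, w⟫_ℝ = 1 := by rw [real_inner_self_eq_norm_sq, hw, one_pow]
  have hx2 : ‖x‖ ^ 2 = 1 - a ^ 2 := by
    rw [hx, norm_sub_sq_real, hu, norm_smul, Real.norm_eq_abs, hw, mul_one, sq_abs, inner_smul_right,
      ← ha]; ring
  have hy2 : ‖y‖ ^ 2 = 1 - b ^ 2 := by
    rw [hy, norm_sub_sq_real, hv, norm_smul, Real.norm_eq_abs, hw, mul_one, sq_abs, inner_smul_right,
      ← hb]; ring
  have hxy : ⟪x, y⟫_ℝ = ⟪u, v⟫_ℝ - a * b := by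
    rw [hx, hy, inner_sub_left, inner_sub_right, inner_sub_right, inner_smul_left, inner_smul_right,
      inner_smul_left, inner_smul_right, real_inner_comm v w, ← hb, ← ha, hww]
    simp only [conj_trivial]; ring
  have hxn : ‖x‖ < 1 / 2 := by nlinarith [norm_nonneg x, hx2]
  have hyn : ‖y‖ < 1 / 2 := by nlinarith [norm_nonneg y, hy2]
  have hcs : |⟪x, y⟫_ℝ| ≤ ‖x‖ * ‖y‖ := abs_real_inner_le_norm x y
  have hxy' : -(1 / 4) < ⟪x, y⟫_ℝ := by
    have : ‖x‖ * ‖y‖ < 1 / 4 := by nlinarith [norm_nonneg x, norm_nonneg y]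
    linarith [(abs_le.1 (le_of_lt (lt_of_le_of_lt hcs this))).1, neg_abs_le ⟪x, y⟫_ℝ, abs_nonneg ⟪x, y⟫_ℝ]
  have hab : 3 / 4 < a * b := by nlinarith
  linarith

/-- **One contact per cap.**  If `x` and `y` are both at distance `1` from `q` and both lie in the
open `30°`-cap about the unit vector `d` (seen from `q`), then `dist x y < 1`. -/
theorem dist_lt_one_of_caps {q x y d : EuclideanSpace ℝ (Fin 3)} (hx : dist q x = 1) (hy : dist q y = 1)
    (hd : ‖d‖ = 1) (hxd : Real.sqrt 3 / 2 < ⟪x - q, d⟫_ℝ) (hyd : Real.sqrt 3 / 2 < ⟪y - q, d⟫_ℝ) :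
    dist x y < 1 := by
  have hu : ‖x - q‖ = 1 := by rw [← dist_eq_norm, dist_comm, hx]
  have hv : ‖y - q‖ = 1 := by rw [← dist_eq_norm, dist_comm, hy]
  have h := real_inner_gt_half_of_caps hu hv hd hxd hyd
  have hsq : dist x y ^ 2 < 1 := by
    rw [dist_eq_norm, show x - y = (x - q) - (y - q) by abel, norm_sub_sq_real, hu, hv]
    linarith
  nlinarith [dist_nonneg (x := x) (y := y)]

/-- In a unit packing a cap about any unit vector holds at most one contact: two contacts of `q`
in `X` registered to the same `d` coincide. -/
theorem capPartner_unique (X : Finset (EuclideanSpace ℝ (Fin 3)))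
    (hX : ∀ p ∈ X, ∀ q ∈ X, p ≠ q → 1 ≤ dist p q) {q x y d : EuclideanSpace ℝ (Fin 3)}
    (hxX : x ∈ X) (hyX : y ∈ X) (hx : dist q x = 1) (hy : dist q y = 1) (hd : ‖d‖ = 1)
    (hxd : Real.sqrt 3 / 2 < ⟪x - q, d⟫_ℝ) (hyd : Real.sqrt 3 / 2 < ⟪y - q, d⟫_ℝ) : x = y := by
  by_contra hne
  have h1 := hX x hxX y hyX hne
  have h2 := dist_lt_one_of_caps hx hy hd hxd hyd
  linarith

/-- **The slot behind a registered contact is blocked.**  If `‖u‖ = ‖d‖ = 1` and `⟪u, d⟫ > √3/2`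
then `‖u − d‖ < 1`. -/
theorem norm_sub_lt_one_of_cap {u d : EuclideanSpace ℝ (Fin 3)} (hu : ‖u‖ = 1) (hd : ‖d‖ = 1)
    (hud : Real.sqrt 3 / 2 < ⟪u, d⟫_ℝ) : ‖u - d‖ < 1 := by
  obtain ⟨-, -, h3⟩ := sqrt_three_div_two_bounds
  have hsq : ‖u - d‖ ^ 2 < 1 := by
    rw [norm_sub_sq_real, hu, hd]; linarith
  nlinarith [norm_nonneg (u - d)]

/-! ### Unit vectors of the substrate lattice -/

/-- **Distinct unit vectors of `Λ₀` make an angle `≥ 60°`:** `⟪d, d'⟫ ≤ 1/2` (they are points of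
`Λ₀` at distance `≥ 1`). -/
theorem real_inner_le_half_of_fcc_unit {d d' : EuclideanSpace ℝ (Fin 3)}
    (hd : d ∈ fccStacking 1 (Real.sqrt (2 / 3))) (hd' : d' ∈ fccStacking 1 (Real.sqrt (2 / 3)))
    (hn : ‖d‖ = 1) (hn' : ‖d'‖ = 1) (hne : d ≠ d') : ⟪d, d'⟫_ℝ ≤ 1 / 2 := by
  have h1 : (1 : ℝ) ≤ dist d d' :=
    le_dist_of_mem_barlowStacking_ideal isHaggSeq_const one_pos fcc_height_sq hd hd' hne
  have h2 : dist d d' ^ 2 = 2 - 2 * ⟪d, d'⟫_ℝ := by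
    rw [dist_eq_norm, norm_sub_sq_real, hn, hn']; ring
  nlinarith

/-- **A contact is registered to at most one bond direction.**  If `x − q` (a unit vector) lies in
the open `30°`-caps about two unit vectors `d, d'` of `Λ₀`, then `d = d'`. -/
theorem capDir_unique {q x d d' : EuclideanSpace ℝ (Fin 3)} (hx : dist q x = 1)
    (hd : d ∈ fccStacking 1 (Real.sqrt (2 / 3))) (hd' : d' ∈ fccStacking 1 (Real.sqrt (2 / 3)))
    (hn : ‖d‖ = 1) (hn' : ‖d'‖ = 1)
    (hxd : Real.sqrt 3 / 2 < ⟪x - q, d⟫_ℝ) (hxd' : Real.sqrt 3 / 2 < ⟪x - q, d'⟫_ℝ) : d = d' := by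
  by_contra hne
  have hu : ‖x - q‖ = 1 := by rw [← dist_eq_norm, dist_comm, hx]
  have h1 := real_inner_le_half_of_fcc_unit hd hd' hn hn' hne
  have h2 := real_inner_gt_half_of_caps hn hn' hu (by rwa [real_inner_comm]) (by rwa [real_inner_comm])
  linarith

/-! ### An abstract double count -/

/-- **Double counting a relation with singleton fibres.**  If every `a ∈ A` is related to at most
one `b ∈ B` and every `b ∈ B` to at most one `a ∈ A`, then the number of `a` with a partner equals
the number of `b` with a partner. -/
theorem card_filter_exists_comm {α β : Type*} (A : Finset α) (B : Finset β) (R : α → β → Prop)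
    [∀ a b, Decidable (R a b)]
    (hA : ∀ a ∈ A, ∀ b ∈ B, ∀ b' ∈ B, R a b → R a b' → b = b')
    (hB : ∀ b ∈ B, ∀ a ∈ A, ∀ a' ∈ A, R a b → R a' b → a = a') :
    (A.filter fun a => ∃ b ∈ B, R a b).card = (B.filter fun b => ∃ a ∈ A, R a b).card := by
  classical
  -- both sides count the related pairs
  have hT : ((A ×ˢ B).filter fun ab => R ab.1 ab.2).card =
      ∑ a ∈ A, (B.filter fun b => R a b).card := by
    rw [card_filter, sum_product]
    refine sum_congr rfl fun a _ => ?_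
    rw [card_filter]
  have hT' : ((A ×ˢ B).filter fun ab => R ab.1 ab.2).card =
      ∑ b ∈ B, (A.filter fun a => R a b).card := by
    rw [card_filter, sum_product_right]
    refine sum_congr rfl fun b _ => ?_
    rw [card_filter]
  have h1 : ∑ a ∈ A, (B.filter fun b => R a b).card = (A.filter fun a => ∃ b ∈ B, R a b).card := by
    rw [card_filter]
    refine sum_congr rfl fun a ha => ?_
    split_ifs with h
    · obtain ⟨b, hb, hab⟩ := h
      rw [card_eq_one]
      refine ⟨b, eq_singleton_iff_unique_mem.2 ⟨mem_filter.2 ⟨hb, hab⟩, fun b' hb' => ?_⟩⟩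
      exact hA a ha b' (mem_filter.1 hb').1 b hb (mem_filter.1 hb').2 hab
    · rw [card_eq_zero, filter_eq_empty_iff]
      exact fun b hb hab => h ⟨b, hb, hab⟩
  have h2 : ∑ b ∈ B, (A.filter fun a => R a b).card = (B.filter fun b => ∃ a ∈ A, R a b).card := by
    rw [card_filter]
    refine sum_congr rfl fun b hb => ?_
    split_ifs with h
    · obtain ⟨a, ha, hab⟩ := h
      rw [card_eq_one]
      refine ⟨a, eq_singleton_iff_unique_mem.2 ⟨mem_filter.2 ⟨ha, hab⟩, fun a' ha' => ?_⟩⟩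
      exact hB b hb a' (mem_filter.1 ha').1 a ha (mem_filter.1 ha').2 hab
    · rw [card_eq_zero, filter_eq_empty_iff]
      exact fun a ha hab => h ⟨a, ha, hab⟩
  rw [← h1, ← hT, hT', h2]

/-! ### The bond star of `Λ₀` -/

/-- Every member of the explicit bond star is a unit vector of `Λ₀`. -/
theorem fccBondStar_mem {d : EuclideanSpace ℝ (Fin 3)}
    (hd : d ∈ ([barlowPos 1 (Real.sqrt (2 / 3)) constHagg 0 1 0, -barlowPos 1 (Real.sqrt (2 / 3)) constHagg 0 1 0,
        barlowPos 1 (Real.sqrt (2 / 3)) constHagg 0 0 1, -barlowPos 1 (Real.sqrt (2 / 3)) constHagg 0 0 1,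
        barlowPos 1 (Real.sqrt (2 / 3)) constHagg 0 1 (-1), -barlowPos 1 (Real.sqrt (2 / 3)) constHagg 0 1 (-1),
        barlowPos 1 (Real.sqrt (2 / 3)) constHagg 1 0 0, -barlowPos 1 (Real.sqrt (2 / 3)) constHagg 1 0 0,
        barlowPos 1 (Real.sqrt (2 / 3)) constHagg (-1) 1 0, -barlowPos 1 (Real.sqrt (2 / 3)) constHagg (-1) 1 0,
        barlowPos 1 (Real.sqrt (2 / 3)) constHagg (-1) 0 1, -barlowPos 1 (Real.sqrt (2 / 3)) constHagg (-1) 0 1] :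
        List (EuclideanSpace ℝ (Fin 3))).toFinset) :
    d ∈ fccStacking 1 (Real.sqrt (2 / 3)) ∧ ‖d‖ = 1 := by
  rw [List.mem_toFinset] at hd
  obtain ⟨h1, h2⟩ := l12_mem_norm hd
  refine ⟨h1, ?_⟩
  nlinarith [norm_nonneg d]

/-- The explicit bond star is closed under negation. -/
theorem fccBondStar_neg_mem {d : EuclideanSpace ℝ (Fin 3)}
    (hd : d ∈ ([barlowPos 1 (Real.sqrt (2 / 3)) constHagg 0 1 0, -barlowPos 1 (Real.sqrt (2 / 3)) constHagg 0 1 0,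
        barlowPos 1 (Real.sqrt (2 / 3)) constHagg 0 0 1, -barlowPos 1 (Real.sqrt (2 / 3)) constHagg 0 0 1,
        barlowPos 1 (Real.sqrt (2 / 3)) constHagg 0 1 (-1), -barlowPos 1 (Real.sqrt (2 / 3)) constHagg 0 1 (-1),
        barlowPos 1 (Real.sqrt (2 / 3)) constHagg 1 0 0, -barlowPos 1 (Real.sqrt (2 / 3)) constHagg 1 0 0,
        barlowPos 1 (Real.sqrt (2 / 3)) constHagg (-1) 1 0, -barlowPos 1 (Real.sqrt (2 / 3)) constHagg (-1) 1 0,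
        barlowPos 1 (Real.sqrt (2 / 3)) constHagg (-1) 0 1, -barlowPos 1 (Real.sqrt (2 / 3)) constHagg (-1) 0 1] :
        List (EuclideanSpace ℝ (Fin 3))).toFinset) :
    -d ∈ ([barlowPos 1 (Real.sqrt (2 / 3)) constHagg 0 1 0, -barlowPos 1 (Real.sqrt (2 / 3)) constHagg 0 1 0,
        barlowPos 1 (Real.sqrt (2 / 3)) constHagg 0 0 1, -barlowPos 1 (Real.sqrt (2 / 3)) constHagg 0 0 1,
        barlowPos 1 (Real.sqrt (2 / 3)) constHagg 0 1 (-1), -barlowPos 1 (Real.sqrt (2 / 3)) constHagg 0 1 (-1),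
        barlowPos 1 (Real.sqrt (2 / 3)) constHagg 1 0 0, -barlowPos 1 (Real.sqrt (2 / 3)) constHagg 1 0 0,
        barlowPos 1 (Real.sqrt (2 / 3)) constHagg (-1) 1 0, -barlowPos 1 (Real.sqrt (2 / 3)) constHagg (-1) 1 0,
        barlowPos 1 (Real.sqrt (2 / 3)) constHagg (-1) 0 1, -barlowPos 1 (Real.sqrt (2 / 3)) constHagg (-1) 0 1] :
        List (EuclideanSpace ℝ (Fin 3))).toFinset := by
  rw [List.mem_toFinset] at hd ⊢
  simp only [List.mem_cons, List.mem_nil_iff, or_false] at hd ⊢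
  rcases hd with rfl | rfl | rfl | rfl | rfl | rfl | rfl | rfl | rfl | rfl | rfl | rfl <;>
    simp only [neg_neg, true_or, or_true]

/-- The explicit bond star has twelve members. -/
theorem fccBondStar_card :
    ([barlowPos 1 (Real.sqrt (2 / 3)) constHagg 0 1 0, -barlowPos 1 (Real.sqrt (2 / 3)) constHagg 0 1 0,
        barlowPos 1 (Real.sqrt (2 / 3)) constHagg 0 0 1, -barlowPos 1 (Real.sqrt (2 / 3)) constHagg 0 0 1,
        barlowPos 1 (Real.sqrt (2 / 3)) constHagg 0 1 (-1), -barlowPos 1 (Real.sqrt (2 / 3)) constHagg 0 1 (-1),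
        barlowPos 1 (Real.sqrt (2 / 3)) constHagg 1 0 0, -barlowPos 1 (Real.sqrt (2 / 3)) constHagg 1 0 0,
        barlowPos 1 (Real.sqrt (2 / 3)) constHagg (-1) 1 0, -barlowPos 1 (Real.sqrt (2 / 3)) constHagg (-1) 1 0,
        barlowPos 1 (Real.sqrt (2 / 3)) constHagg (-1) 0 1, -barlowPos 1 (Real.sqrt (2 / 3)) constHagg (-1) 0 1] :
        List (EuclideanSpace ℝ (Fin 3))).toFinset.card = 12 := by
  have key : ([barlowPos 1 (Real.sqrt (2 / 3)) constHagg 0 1 0, -barlowPos 1 (Real.sqrt (2 / 3)) constHagg 0 1 0,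
        barlowPos 1 (Real.sqrt (2 / 3)) constHagg 0 0 1, -barlowPos 1 (Real.sqrt (2 / 3)) constHagg 0 0 1,
        barlowPos 1 (Real.sqrt (2 / 3)) constHagg 0 1 (-1), -barlowPos 1 (Real.sqrt (2 / 3)) constHagg 0 1 (-1),
        barlowPos 1 (Real.sqrt (2 / 3)) constHagg 1 0 0, -barlowPos 1 (Real.sqrt (2 / 3)) constHagg 1 0 0,
        barlowPos 1 (Real.sqrt (2 / 3)) constHagg (-1) 1 0, -barlowPos 1 (Real.sqrt (2 / 3)) constHagg (-1) 1 0,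
        barlowPos 1 (Real.sqrt (2 / 3)) constHagg (-1) 0 1, -barlowPos 1 (Real.sqrt (2 / 3)) constHagg (-1) 0 1] :
        List (EuclideanSpace ℝ (Fin 3))) =
      ([((0 : ℤ), (1 : ℤ), (0 : ℤ)), (0, -1, 0), (0, 0, 1), (0, 0, -1), (0, 1, -1), (0, -1, 1),
        (1, 0, 0), (-1, 0, 0), (-1, 1, 0), (1, -1, 0), (-1, 0, 1), (1, 0, -1)] : List (ℤ × ℤ × ℤ)).map
        fun t => barlowPos 1 (Real.sqrt (2 / 3)) constHagg t.1 t.2.1 t.2.2 := by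
    simp only [List.map_cons, List.map_nil, ← barlowPos_fcc_neg]
    norm_num
  rw [key, List.toFinset_card_of_nodup]
  · simp
  · refine List.Nodup.map (fun s t hst => ?_) (by decide)
    have := barlowPos_fcc_injective hst
    ext <;> simp_all [Prod.ext_iff]

end Summit.Ventures.Crystal3D.Theorems

end
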